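/-
b2b-lace packet, ANALYTIC ORACLE seat gen 9 (unit `b2b-lace-oracle-g9`).  Leaf L2 of the (S2b)-IMPR interface
(HOME/GAPS.md "(S2b) SPLIT", items (I3)–(I4)): [NoBLE17] §3.3.4 "Decomposition of the two-point function" and
App. C "Decomposition of `ΔĜ_z(k)` for the bootstrap function `f₃`", in DERIVATIVE-FREE form acting on the L1
integrand `tauWHat` (= the paper's `−Δτ̂_p`).  d-generic; kernel proofs; no numeral; no dimension sentence;
nothing cited as a fact.
-/
import Literature.Probability.FitznerVanDerHofstad2017.NobleWeightedDiagramFourier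
import Literature.Probability.FitznerVanDerHofstad2017.NobleSimplifiedFormF3
import Literature.Probability.FitznerVanDerHofstad2017.SrwIntegralTU
import Literature.Barriers.CriticalPhenomena.LaceExpansionFourier
import HarnessLib

/-!
# App. C of [NoBLE17]: `−ΔĜ_z(k) = Σ_{i=1}^5 Ĥ_i(k)`, derivative-free, and the objects `Ĉ*, Ê, M̂*, Ĥ₁–Ĥ₅`

CITATION HEADER (PLACEMENT v2). Part of a certified REPRODUCTION of R. Fitzner, R. van der Hofstad,
*Generalized approach to the non-backtracking lace expansion*, Probab. Theory Related Fields 169 (2017)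
1041–1119 [NoBLE17] (arXiv:1506.07969), §3.3.4 (3.40), (3.44)–(3.45), (3.52)–(3.57) (PTRF pp. 1072–1074) and
Appendix C (C.1)–(C.14) (PTRF pp. 1107–1110), with §3.3.3 (3.22)–(3.23) (p. 1069) and §3.3.5 (3.80) (p. 1078), as consumed by *Mean-field behavior for nearest-neighbor
percolation in `d > 10`*, Electron. J. Probab. 22 (2017) no. 43 [FvdH17], Prop. 2.2 / §3.3 (the `f₃` bound).

## The printed statements (verbatim, [NoBLE17])

> §3.3.4, "Decomposition of the two-point function" (p. 1072): "For the SRW-contributions, we define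
> `Ĉ*(k) = 1/(1 − F̂_z(0) + α_{F,z}[1 − D̂(k)])` (3.40). … We abbreviate
> `δ_{R,F}(k) = R̂_{F,z}(0) − R̂_{F,z}(k)`, `δ_{R,Φ}(k) = R̂_{Φ,z}(0) − R̂_{Φ,z}(k)` (3.44),
> `Ê(k) = δ_{R,F}(k) Ĉ*(k)/(1 − F̂_z(k))`, `M̂*(k) = D̂(k) − 2 D̂^{sin}(k) Ĉ*(k)` (3.45)."
> "Decomposition of `ΔĜ_z(k)`" (p. 1073): "We decompose `ΔĜ_z(k)` into five contributions `Ĥ_i(k)`. …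
> `Ĥ₁(k) = (α_F (c_Φ + α_Φ D̂(k)) Ĉ*(k) + α_Φ) Ĉ*(k) M̂*(k)` (3.52),
> `Ĥ₂(k) = −(α_F (c_Φ + α_Φ D̂(k)) (Ĉ*(k) + 1/(1 − F̂_z(k))) + α_Φ) Ê(k) M̂*(k) + α_F R̂_{Φ,z}(k)/(1 − F̂_z(k))² · M̂*(k)` (3.53),
> `Ĥ₃(k) = 2 (D̂^{sin}(k)/(1 − F̂_z(k))) (α_F Ĝ_z(k) + α_Φ) (Ê(k) − (α_F − 1)/(1 − F̂_z(k)))` (3.54),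
> `Ĥ₄(k) = −ΔR̂_{Φ,z}(k)/(1 − F̂_z(k)) − (ΔR̂_{F,z}(k)/(1 − F̂_z(k))) Ĝ_z(k)` (3.55),
> `Ĥ₅(k) = −2 [Σ_s (∂_s R̂_{F,z}(k))² + 2α_F ∂_s D̂(k) ∂_s R̂_{F,z}(k)]/(1 − F̂_z(k))² · Ĝ_z(k)
>          − (2/(1 − F̂_z(k))²) Σ_s (∂_s R̂_{Φ,z}(k) α_F ∂_s D̂(k) + ∂_s Φ̂_z(k) ∂_s R̂_{F,z}(k))` (3.56).
> In Appendix C, we explicitly show that `−ΔĜ_z(k) = Σ_{i=1}^5 Ĥ_i(k)` (3.57). This computation is quite long and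
> tedious. However, since it is crucial to our analysis, we give the derivation in detail in Appendix C."
> App. C (p. 1107): "Our strategy is to first expand
> `ΔĜ_z(k) = ΔΦ̂_z(k)/(1 − F̂_z(k)) + Φ̂_z(k) Δ(1/(1 − F̂_z(k))) + 2Σ_s ∂_sΦ̂_z(k) ∂_s(1/(1 − F̂_z(k)))` (C.1)
> and then group them in terms of their common factors. … `1/(1 − F̂_z(k)) = Ĉ*(k) − Ê(k)` (C.2),
> `1/(1 − F̂_z(k))² = Ĉ*(k)² − Ê(k)Ĉ*(k) − Ê(k)/(1 − F̂_z(k))` (C.3),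
> `1/(1 − F̂_z(k))³ = Ĉ*(k)³ − Ê(k)Ĉ*(k)² − Ê(k)Ĉ*(k)/(1 − F̂_z(k)) − Ê(k)/(1 − F̂_z(k))²` (C.4), …
> `ΔΦ̂_z(k) = −α_{Φ,z} D̂(k) + ΔR̂_{Φ,z}(k)`, `ΔF̂_z(k) = −α_{F,z} D̂(k) + ΔR̂_{F,z}(k)` (C.5). …
> This completes the derivation of the split into `Ĥ₁(k)–Ĥ₅(k)`." (p. 1110); §3.3.3 (3.22)–(3.23) (p. 1069):
> `ΔD̂(k) = Σ_s ∂_s²D̂(k) = −(1/d)Σ_s cos(k_s) = −D̂(k)`, `Σ_s (∂_s D̂(k))² = (1/d²) Σ_s sin²(k_s) =: D̂^{sin}(k)`;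
> §3.3.5 (3.80) (p. 1078): `∂_s f̂(k) = i Σ_x x_s f(x) e^{ik·x}`; §1.3 (1.35)–(1.36) (p. 1050):
> `Φ̂_z(k) := c_{Φ,z} + α_{Φ,z} D̂(k) + R̂_{Φ,z}(k)`, `F̂_z(k) := c_{F,z} + α_{F,z} D̂(k) + R̂_{F,z}(k)`.

## What is here (namespace `Literature.Probability.FitznerVanDerHofstad2017`), and how the derivatives are typed

The paper differentiates lattice Fourier transforms on the torus.  We never do: for `f : ℤ^d → ℝ`,
`∂_s f̂(k) = −Σ_x x_s f(x) sin(k·x)` and `−Δf̂(k) = Σ_x ‖x‖₂² f(x) cos(k·x)`, so we TYPE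
`gradFT s f k := Σ_x sin(k·x) · x_s f(x)` (`= −∂_s f̂(k)`; every term of (3.52)–(3.56) carries a PRODUCT of two
first derivatives, so the sign is immaterial) and `lapFT f k := Σ_x cos(k·x) ‖x‖₂² f(x)` (`= −Δf̂(k)`), and the
calculus rules (C.1), (C.5) become x-space identities (`‖x‖₂² = ‖y‖₂² + ‖x−y‖₂² + 2 y·(x−y)`) pushed through the
(general, sine-corrected) convolution theorems `(f⋆g)^ = f̂ĝ − f̃g̃`, `(f⋆g)~ = f̃ĝ + f̂g̃` (`~` = sine transform).

* §1 `sinFT`, `mulCoord`, `mulNormSq`, `gradFT`, `lapFT`; parity; the two convolution theorems; the x-space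
  Leibniz rules; the transforms of `δ₀` and `D` (`lapFT D = D̂`, `gradFT s D = sin(k_s)/d`,
  `Σ_s (gradFT s D)² = D̂^{sin}`).
* §2 Fourier uniqueness through the even part (tree inversion `integral_cube_cos_kdot_mul_cosFT`), and its
  consequence: for ANY symmetric summable `G` with `Σ‖x‖²|G| < ∞` whose transform satisfies the simplified NoBLE
  form `Ĝ(k)(1 − F̂(k)) = Φ̂(k)` on `[−π,π]^d` with `Φ̂ = c_Φ + α_Φ D̂ + R̂_Φ`, `F̂ = c_F + α_F D̂ + R̂_F`
  (`Σ‖x‖²|R_•| < ∞`; NO symmetry of `R_Φ, R_F` is needed), the derivative-free forms of (C.1):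
  `Ĝ(1 − F̂) = Φ̂` EVERYWHERE, `∂Ĝ·(1 − F̂) = ∂Φ̂ + ∂F̂·Ĝ`, `(−ΔĜ)(1 − F̂) = −ΔΦ̂ + (−ΔF̂)Ĝ − 2Σ_s ∂_sF̂ ∂_sĜ`.
* §3 THE ALGEBRA OF APP. C as a kernel identity: `LapAtoms` (the fourteen real numbers a point `k` contributes:
  `c_Φ, α_Φ, α_F, D̂, D̂^{sin}, R̂_Φ, Q = 1 − F̂, δ_{R,F}, −ΔR̂_Φ, −ΔR̂_F` and the four gradient sums), the printed
  `Ĉ* = 1/(Q − δ_{R,F})` (equal to (3.40) since `1 − F̂(0) + α_F[1 − D̂(k)] = (1 − F̂(k)) − δ_{R,F}(k)`), `Ê`, `M̂*`,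
  `Ĥ₁ … Ĥ₅` VERBATIM from (3.52)–(3.56), the quotient-rule form `negLapG` of (C.1), and
  **`LapAtoms.negLapG_eq_sum_H : Q ≠ 0 → Q − δ_{R,F} ≠ 0 → negLapG = Ĥ₁ + Ĥ₂ + Ĥ₃ + Ĥ₄ + Ĥ₅`** — (3.57), i.e.
  the whole of App. C, checked by the kernel as a rational-function identity (`field_simp; ring`); with
  (C.2)–(C.4).
* §4 The DICTIONARY: `lapAtomsAt d c_Φ α_Φ c_F α_F R_Φ R_F k` instantiates the atoms (`Dhat`, `Dsin`, `cosFT`,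
  `lapFT`, `gradFT`), `lapFT_eq_sum_H` (abstract `G`), and for percolation `tauWHat d p = lapFT τ_p` and
  **`tauWHat_eq_sum_H`**: for `2 ≤ d`, `p < p_c`, witnesses of the simplified form with finite weighted remainder
  sums, at every `k` with `1 − F̂(k) ≠ 0 ≠ 1 − F̂(0) + α_F[1 − D̂(k)]`:
  `tauWHat d p k = Ĥ₁(k) + Ĥ₂(k) + Ĥ₃(k) + Ĥ₄(k) + Ĥ₅(k)`;
  `NobleSimplifiedFormF3At.exists_lapAtoms` reads the witnesses off the L0 form.

Not here: the positivity `1 − F̂_z(k) > 0` and the bounds (3.43), (3.46)–(3.51) on `Ĉ*, K̲, Ê` ("Bounds on key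
quantities"), and the bounds (3.59)–(3.87) on `ℋ_{i}` (leaves L2b, L3–L7).
-/

noncomputable section

namespace Literature.Probability.FitznerVanDerHofstad2017

open MeasureTheory Real Finset Filter
open scoped BigOperators
open Literature.Probability.LatticeModels
open Literature.Probability.Percolation
open Literature.Barriers.CriticalPhenomena
open Literature.Barriers.CriticalPhenomena.SpreadOutIsing (delta0 delta0_zero delta0_of_ne_zero latticeConv)
open Literature.Probability.RandomPlanarGeometry.SAW.Zd (normSq normSq_nonneg)

variable {d : ℕ}

/-! ## §1 The sine transform, the coordinate and second-moment weights, parity, convolution theorems -/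

/-- The sine lattice transform `f̃(k) = Σ_x sin(k·x) f(x)` (the odd part of `Σ_x f(x) e^{ik·x}`).
[cite: HeydenreichVanDerHofstad2017, (1.2.16)] -/
def sinFT (f : Site d → ℝ) (k : Fin d → ℝ) : ℝ := ∑' x : Site d, Real.sin (kdot k x) * f x

/-- The coordinate weight `x ↦ x_s f(x)`. [folklore] -/
def mulCoord (s : Fin d) (f : Site d → ℝ) : Site d → ℝ := fun x => (x s : ℝ) * f x

/-- The second-moment weight `x ↦ ‖x‖₂² f(x)`. [folklore] -/
def mulNormSq (f : Site d → ℝ) : Site d → ℝ := fun x => normSq x * f x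

/-- `gradFT s f k = Σ_x sin(k·x) x_s f(x)` — the paper's `−∂_s f̂(k)` (`∂_s Σ_x f(x)cos(k·x) = −Σ_x x_s f(x) sin(k·x)`),
typed without derivatives. [cite: FitznerVanDerHofstad2016NoBLE, §3.3.5 (3.80) (∂_s f̂(k) = iΣ_x x_s f(x) e^{ik·x}), PTRF p. 1078] -/
def gradFT (s : Fin d) (f : Site d → ℝ) (k : Fin d → ℝ) : ℝ := sinFT (mulCoord s f) k

/-- `lapFT f k = Σ_x cos(k·x) ‖x‖₂² f(x)` — the paper's `−Δf̂(k)` (`ΔĜ_z(k) = −Σ_x ‖x‖₂² G_z(x) e^{ik·x}`), typed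
without derivatives. [cite: FitznerVanDerHofstad2016NoBLE, §3.3.1, the display for ΔĜ_z(k) following (3.10), PTRF p. 1067] -/
def lapFT (f : Site d → ℝ) (k : Fin d → ℝ) : ℝ := cosFT (mulNormSq f) k

/-- Unfolding lemma. [folklore] -/
theorem sinFT_def (f : Site d → ℝ) (k : Fin d → ℝ) : sinFT f k = ∑' x : Site d, Real.sin (kdot k x) * f x := rfl
/-- Unfolding lemma. [folklore] -/
theorem mulCoord_apply (s : Fin d) (f : Site d → ℝ) (x : Site d) : mulCoord s f x = (x s : ℝ) * f x := rfl
/-- Unfolding lemma. [folklore] -/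
theorem mulNormSq_apply (f : Site d → ℝ) (x : Site d) : mulNormSq f x = normSq x * f x := rfl
/-- Unfolding lemma. [folklore] -/
theorem gradFT_def (s : Fin d) (f : Site d → ℝ) (k : Fin d → ℝ) :
    gradFT s f k = ∑' x : Site d, Real.sin (kdot k x) * ((x s : ℝ) * f x) := rfl
/-- Unfolding lemma. [folklore] -/
theorem lapFT_def (f : Site d → ℝ) (k : Fin d → ℝ) :
    lapFT f k = ∑' x : Site d, Real.cos (kdot k x) * (normSq x * f x) := rfl

/-! ### Elementary facts on `normSq` -/

/-- `‖−x‖₂² = ‖x‖₂²`. [folklore] -/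
theorem normSq_neg' (x : Site d) : normSq (-x) = normSq x := by
  simp [normSq]

/-- `x_s² ≤ ‖x‖₂²`. [folklore] -/
theorem sq_coord_le_normSq (x : Site d) (s : Fin d) : (x s : ℝ) ^ 2 ≤ normSq x :=
  Finset.single_le_sum (f := fun i => ((x i : ℤ) : ℝ) ^ 2) (fun _ _ => sq_nonneg _) (Finset.mem_univ s)

/-- `|x_s| ≤ 1 + ‖x‖₂²`. [folklore] -/
theorem abs_coord_le_one_add_normSq (x : Site d) (s : Fin d) : |(x s : ℝ)| ≤ 1 + normSq x := by
  have h1 : |(x s : ℝ)| ≤ 1 + (x s : ℝ) ^ 2 := by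
    nlinarith [sq_nonneg (|(x s : ℝ)| - 1), abs_nonneg (x s : ℝ), sq_abs (x s : ℝ)]
  exact h1.trans (by linarith [sq_coord_le_normSq x s])

/-- `‖x‖₂² = ‖y‖₂² + ‖x − y‖₂² + 2 Σ_s y_s (x − y)_s`. [folklore] -/
theorem normSq_eq_add_add (x y : Site d) :
    normSq x = normSq y + normSq (x - y) + 2 * ∑ s, (y s : ℝ) * ((x - y) s : ℝ) := by
  simp only [normSq, Pi.sub_apply, Int.cast_sub, Finset.mul_sum, ← Finset.sum_add_distrib]
  exact Finset.sum_congr rfl fun s _ => by ring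

/-- `‖e_j‖₂² = 1`. [folklore] -/
theorem normSq_single_one (j : Fin d) : normSq (Pi.single j (1 : ℤ) : Site d) = 1 := by
  simp only [normSq]
  rw [Finset.sum_eq_single j]
  · simp
  · intro i _ hi; simp [Pi.single_eq_of_ne hi]
  · intro h; exact absurd (Finset.mem_univ j) h

/-- `‖−e_j‖₂² = 1`. [folklore] -/
theorem normSq_neg_single_one (j : Fin d) : normSq (-Pi.single j (1 : ℤ) : Site d) = 1 := by
  rw [normSq_neg', normSq_single_one]

/-! ### Summability of the weights -/

/-- `Σ‖x‖²|f| < ∞ ⇒ ‖·‖²f` summable. [folklore] -/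
theorem summable_mulNormSq_of_abs {f : Site d → ℝ} (h : Summable fun x => normSq x * |f x|) :
    Summable (mulNormSq f) := by
  refine Summable.of_norm ?_
  refine h.congr fun x => ?_
  rw [mulNormSq_apply, norm_mul, Real.norm_eq_abs, Real.norm_eq_abs, abs_of_nonneg (normSq_nonneg x)]

/-- `Σ‖x‖²|f| < ∞ ⇔ ‖·‖²f` summable. [folklore] -/
theorem summable_abs_mulNormSq_iff {f : Site d → ℝ} :
    (Summable fun x => normSq x * |f x|) ↔ Summable (mulNormSq f) := by
  have e : (fun x => normSq x * |f x|) = fun x => ‖mulNormSq f x‖ := funext fun x => by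
    rw [mulNormSq_apply, norm_mul, Real.norm_eq_abs, Real.norm_eq_abs, abs_of_nonneg (normSq_nonneg x)]
  rw [e]
  exact ⟨Summable.of_norm, fun h => h.norm⟩

/-- `f, ‖·‖²f` summable `⇒ x_s f` summable. [folklore] -/
theorem summable_mulCoord {f : Site d → ℝ} (hf : Summable f) (h2 : Summable (mulNormSq f)) (s : Fin d) :
    Summable (mulCoord s f) :=
  Summable.of_norm_bounded (hf.norm.add h2.norm) fun x => by
    rw [mulCoord_apply, norm_mul, Real.norm_eq_abs, Real.norm_eq_abs, Real.norm_eq_abs, mulNormSq_apply,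
      abs_mul, abs_of_nonneg (normSq_nonneg x)]
    have := abs_coord_le_one_add_normSq x s
    nlinarith [abs_nonneg (f x), normSq_nonneg x]

/-! ### Parity -/

/-- The sine transform of an even function vanishes. [folklore] -/
theorem sinFT_eq_zero_of_even {f : Site d → ℝ} (h : ∀ x, f (-x) = f x) (k : Fin d → ℝ) : sinFT f k = 0 :=
  tsum_sin_kdot_mul_eq_zero h k

/-- The cosine transform of an odd function vanishes. [folklore] -/
theorem cosFT_eq_zero_of_odd {f : Site d → ℝ} (h : ∀ x, f (-x) = -f x) (k : Fin d → ℝ) : cosFT f k = 0 := by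
  set g : Site d → ℝ := fun x => Real.cos (kdot k x) * f x with hg
  have h1 : ∑' x, g x = ∑' x, g (-x) := ((Equiv.neg (Site d)).tsum_eq g).symm
  have h2 : ∀ x, g (-x) = -g x := fun x => by
    simp only [hg, kdot_neg, Real.cos_neg, h, mul_neg]
  simp_rw [h2, tsum_neg] at h1
  show ∑' x, g x = 0
  linarith

/-- `x_s f` is odd for even `f`. [folklore] -/
theorem mulCoord_neg_of_even {f : Site d → ℝ} (h : ∀ x, f (-x) = f x) (s : Fin d) (x : Site d) :
    mulCoord s f (-x) = -mulCoord s f x := by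
  simp [mulCoord, h x]

/-- `‖·‖² f` is even for even `f`. [folklore] -/
theorem mulNormSq_neg_of_even {f : Site d → ℝ} (h : ∀ x, f (-x) = f x) (x : Site d) :
    mulNormSq f (-x) = mulNormSq f x := by
  simp [mulNormSq, normSq_neg', h x]

/-- `(x_s G)^ = 0` for even `G`. [folklore] -/
theorem cosFT_mulCoord_eq_zero_of_even {f : Site d → ℝ} (h : ∀ x, f (-x) = f x) (s : Fin d) (k : Fin d → ℝ) :
    cosFT (mulCoord s f) k = 0 :=
  cosFT_eq_zero_of_odd (mulCoord_neg_of_even h s) k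

/-- `(‖·‖² G)~ = 0` for even `G`. [folklore] -/
theorem sinFT_mulNormSq_eq_zero_of_even {f : Site d → ℝ} (h : ∀ x, f (-x) = f x) (k : Fin d → ℝ) :
    sinFT (mulNormSq f) k = 0 :=
  sinFT_eq_zero_of_even (mulNormSq_neg_of_even h) k

/-! ### The convolution theorems with the sine correction -/

section Conv

variable {f g : Site d → ℝ}

/-- Fubini for a bounded weight against a convolution: `Σ_x φ(x)(f⋆g)(x) = Σ_y f(y) Σ_z φ(z + y) g(z)`. [folklore] -/
theorem tsum_mul_latticeConv_eq {φ : Site d → ℝ} (hφ : ∀ x, |φ x| ≤ 1) (hf : Summable f) (hg : Summable g) :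
    ∑' x, φ x * latticeConv f g x = ∑' y, f y * ∑' z, φ (z + y) * g z := by
  have hfam := summable_latticeConv_family_of_summable hf hg
  have hF' : Summable fun xy : Site d × Site d => φ xy.1 * (f xy.2 * g (xy.1 - xy.2)) :=
    Summable.of_norm_bounded (g := fun xy : Site d × Site d => ‖f xy.2 * g (xy.1 - xy.2)‖) hfam.norm
      fun xy => by
        rw [norm_mul, Real.norm_eq_abs]
        exact mul_le_of_le_one_left (norm_nonneg _) (hφ _)
  have hF : Summable (Function.uncurry fun x y : Site d => φ x * (f y * g (x - y))) := hF'
  calc ∑' x, φ x * latticeConv f g x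
      = ∑' x, ∑' y, φ x * (f y * g (x - y)) := by
        simp only [latticeConv, ← tsum_mul_left]
    _ = ∑' y, ∑' x, φ x * (f y * g (x - y)) := hF.tsum_comm.symm
    _ = ∑' y, f y * ∑' z, φ (z + y) * g z := by
        refine tsum_congr fun y => ?_
        have e1 : (fun x => φ x * (f y * g (x - y))) = fun x => f y * (φ x * g (x - y)) :=
          funext fun x => by ring
        rw [e1, tsum_mul_left, tsum_mul_shift_sub (fun x => φ x) g y]

/-- **Convolution theorem for the cosine transform, general form**: `(f⋆g)^(k) = f̂(k)ĝ(k) − f̃(k)g̃(k)`.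
[cite: HeydenreichVanDerHofstad2017, (1.2.16)–(1.2.17) and (6.1.3)] -/
theorem cosFT_latticeConv_eq_sub (hf : Summable f) (hg : Summable g) (k : Fin d → ℝ) :
    cosFT (latticeConv f g) k = cosFT f k * cosFT g k - sinFT f k * sinFT g k := by
  rw [cosFT, tsum_mul_latticeConv_eq (fun x => Real.abs_cos_le_one _) hf hg]
  have inner : ∀ y, ∑' z, Real.cos (kdot k (z + y)) * g z =
      Real.cos (kdot k y) * cosFT g k - Real.sin (kdot k y) * sinFT g k := fun y => by
    have e2 : (fun z => Real.cos (kdot k (z + y)) * g z) =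
        fun z => Real.cos (kdot k y) * (Real.cos (kdot k z) * g z) -
          Real.sin (kdot k y) * (Real.sin (kdot k z) * g z) := funext fun z => by
      rw [Literature.Probability.Percolation.kdot_add, Real.cos_add]; ring
    rw [e2, ((summable_cos_kdot_mul hg k).mul_left _).tsum_sub ((summable_sin_kdot_mul hg k).mul_left _),
      tsum_mul_left, tsum_mul_left, cosFT, sinFT]
  simp_rw [inner]
  have e3 : (fun y => f y * (Real.cos (kdot k y) * cosFT g k - Real.sin (kdot k y) * sinFT g k)) =
      fun y => cosFT g k * (Real.cos (kdot k y) * f y) - sinFT g k * (Real.sin (kdot k y) * f y) :=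
    funext fun y => by ring
  rw [e3, ((summable_cos_kdot_mul hf k).mul_left _).tsum_sub ((summable_sin_kdot_mul hf k).mul_left _),
    tsum_mul_left, tsum_mul_left]
  simp only [cosFT, sinFT]
  ring

/-- **Convolution theorem for the sine transform**: `(f⋆g)~(k) = f̃(k)ĝ(k) + f̂(k)g̃(k)`.
[cite: HeydenreichVanDerHofstad2017, (1.2.16)–(1.2.17) and (6.1.3)] -/
theorem sinFT_latticeConv_eq_add (hf : Summable f) (hg : Summable g) (k : Fin d → ℝ) :
    sinFT (latticeConv f g) k = sinFT f k * cosFT g k + cosFT f k * sinFT g k := by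
  rw [sinFT, tsum_mul_latticeConv_eq (fun x => Real.abs_sin_le_one _) hf hg]
  have inner : ∀ y, ∑' z, Real.sin (kdot k (z + y)) * g z =
      Real.sin (kdot k y) * cosFT g k + Real.cos (kdot k y) * sinFT g k := fun y => by
    have e2 : (fun z => Real.sin (kdot k (z + y)) * g z) =
        fun z => Real.sin (kdot k y) * (Real.cos (kdot k z) * g z) +
          Real.cos (kdot k y) * (Real.sin (kdot k z) * g z) := funext fun z => by
      rw [Literature.Probability.Percolation.kdot_add, Real.sin_add]; ring
    rw [e2, ((summable_cos_kdot_mul hg k).mul_left _).tsum_add ((summable_sin_kdot_mul hg k).mul_left _),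
      tsum_mul_left, tsum_mul_left, cosFT, sinFT]
  simp_rw [inner]
  have e3 : (fun y => f y * (Real.sin (kdot k y) * cosFT g k + Real.cos (kdot k y) * sinFT g k)) =
      fun y => cosFT g k * (Real.sin (kdot k y) * f y) + sinFT g k * (Real.cos (kdot k y) * f y) :=
    funext fun y => by ring
  rw [e3, ((summable_sin_kdot_mul hf k).mul_left _).tsum_add ((summable_cos_kdot_mul hf k).mul_left _),
    tsum_mul_left, tsum_mul_left]
  simp only [cosFT, sinFT]
  ring

/-! ### The x-space Leibniz rules -/

/-- `x_s (f⋆g)(x) = ((x_s f)⋆g)(x) + (f⋆(x_s g))(x)` (the x-space form of `∂_s(f̂ĝ) = ∂_sf̂ ĝ + f̂ ∂_sĝ`).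
[folklore] -/
theorem mulCoord_latticeConv (s : Fin d) (hf : Summable f) (hg : Summable g) (hfs : Summable (mulCoord s f))
    (hgs : Summable (mulCoord s g)) (x : Site d) :
    mulCoord s (latticeConv f g) x = latticeConv (mulCoord s f) g x + latticeConv f (mulCoord s g) x := by
  have hA : Summable fun y => (y s : ℝ) * f y * g (x - y) := summable_latticeConv_inner_of_summable hfs hg x
  have hB : Summable fun y => f y * (((x - y) s : ℝ) * g (x - y)) :=
    summable_latticeConv_inner_of_summable hf hgs x
  show (x s : ℝ) * ∑' y, f y * g (x - y) =
    ∑' y, (y s : ℝ) * f y * g (x - y) + ∑' y, f y * (((x - y) s : ℝ) * g (x - y))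
  rw [← tsum_mul_left, ← hA.tsum_add hB]
  refine tsum_congr fun y => ?_
  simp only [Pi.sub_apply, Int.cast_sub]
  ring

/-- `‖x‖₂² (f⋆g)(x) = ((‖·‖²f)⋆g)(x) + (f⋆(‖·‖²g))(x) + 2 Σ_s ((x_s f)⋆(x_s g))(x)` (the x-space form of
`Δ(f̂ĝ) = Δf̂ ĝ + f̂ Δĝ + 2∇f̂·∇ĝ`). [folklore] -/
theorem mulNormSq_latticeConv (hf : Summable f) (hg : Summable g) (hf2 : Summable (mulNormSq f))
    (hg2 : Summable (mulNormSq g)) (x : Site d) :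
    mulNormSq (latticeConv f g) x = latticeConv (mulNormSq f) g x + latticeConv f (mulNormSq g) x +
      2 * ∑ s, latticeConv (mulCoord s f) (mulCoord s g) x := by
  have hA : Summable fun y => normSq y * f y * g (x - y) := summable_latticeConv_inner_of_summable hf2 hg x
  have hB : Summable fun y => f y * (normSq (x - y) * g (x - y)) :=
    summable_latticeConv_inner_of_summable hf hg2 x
  have hC : ∀ s, Summable fun y => (y s : ℝ) * f y * (((x - y) s : ℝ) * g (x - y)) := fun s =>
    summable_latticeConv_inner_of_summable (summable_mulCoord hf hf2 s) (summable_mulCoord hg hg2 s) x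
  have hC' : Summable fun y => (2 : ℝ) * ∑ s, (y s : ℝ) * f y * (((x - y) s : ℝ) * g (x - y)) :=
    (summable_sum fun s _ => hC s).mul_left 2
  show normSq x * ∑' y, f y * g (x - y) =
    ∑' y, normSq y * f y * g (x - y) + ∑' y, f y * (normSq (x - y) * g (x - y)) +
      2 * ∑ s, ∑' y, (y s : ℝ) * f y * (((x - y) s : ℝ) * g (x - y))
  rw [← Summable.tsum_finsetSum (fun s _ => hC s), ← tsum_mul_left (a := (2 : ℝ)),
    ← tsum_mul_left (a := normSq x), ← hA.tsum_add hB, ← (hA.add hB).tsum_add hC']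
  refine tsum_congr fun y => ?_
  have e : ∑ s, (y s : ℝ) * f y * (((x - y) s : ℝ) * g (x - y)) =
      (∑ s, (y s : ℝ) * ((x - y) s : ℝ)) * (f y * g (x - y)) := by
    rw [Finset.sum_mul]; exact Finset.sum_congr rfl fun s _ => by ring
  rw [e, normSq_eq_add_add x y]
  ring

end Conv

/-! ### The transforms of `δ₀` and of the step distribution `D` -/

/-- `‖x‖₂² δ₀(x) = 0`. [folklore] -/
theorem mulNormSq_delta0 : mulNormSq (delta0 : Site d → ℝ) = 0 := by
  funext x
  by_cases hx : x = 0
  · subst hx; simp [mulNormSq, normSq]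
  · simp [mulNormSq, delta0_of_ne_zero hx]

/-- `x_s δ₀(x) = 0`. [folklore] -/
theorem mulCoord_delta0 (s : Fin d) : mulCoord s (delta0 : Site d → ℝ) = 0 := by
  funext x
  by_cases hx : x = 0
  · subst hx; simp [mulCoord]
  · simp [mulCoord, delta0_of_ne_zero hx]

/-- `0̃ = 0`. [folklore] -/
theorem sinFT_zero_fun (k : Fin d → ℝ) : sinFT (0 : Site d → ℝ) k = 0 := by simp [sinFT]
/-- `0̂ = 0`. [folklore] -/
theorem cosFT_zero_fun (k : Fin d → ℝ) : cosFT (0 : Site d → ℝ) k = 0 := by simp [cosFT]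

/-- `−Δδ̂₀ = 0`. [folklore] -/
theorem lapFT_delta0 (k : Fin d → ℝ) : lapFT (delta0 : Site d → ℝ) k = 0 := by
  rw [lapFT, mulNormSq_delta0, cosFT_zero_fun]

/-- `∂_s δ̂₀ = 0`. [folklore] -/
theorem gradFT_delta0 (s : Fin d) (k : Fin d → ℝ) : gradFT s (delta0 : Site d → ℝ) k = 0 := by
  rw [gradFT, mulCoord_delta0, sinFT_zero_fun]

/-- The neighbour sum: `Σ_x D(x) φ(x) = (1/2d) Σ_j [φ(e_j) + φ(−e_j)]`. [cite: FitznerVanDerHofstad2016NoBLE, (1.1) (D(x) = 𝟙{‖x‖₁ = 1}/(2d))] -/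
theorem tsum_srwStep_mul (hd : 1 ≤ d) (φ : Site d → ℝ) :
    ∑' x, srwStep d x * φ x =
      (∑ j : Fin d, (φ (Pi.single j 1) + φ (-Pi.single j 1))) / (2 * d) := by
  have e : ∀ x, srwStep d x * φ x = (1 / (2 * d)) * ∑ j : Fin d,
      (φ x * (if x = Pi.single j 1 then (1 : ℝ) else 0) + φ x * (if x = -Pi.single j 1 then (1 : ℝ) else 0)) :=
    fun x => by
      rw [srwStep_eq_bondJ_one hd, bondJ_eq_mul_sum_ite, Set.Icc.coe_one, one_mul, Finset.mul_sum,
        Finset.sum_mul, Finset.mul_sum]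
      exact Finset.sum_congr rfl fun j _ => by ring
  have hs : ∀ j : Fin d, Summable fun x : Site d =>
      φ x * (if x = Pi.single j 1 then (1 : ℝ) else 0) + φ x * (if x = -Pi.single j 1 then (1 : ℝ) else 0) :=
    fun j => by
      refine Summable.add ?_ ?_
      · refine summable_of_ne_finset_zero (s := {Pi.single j 1}) fun x hx => ?_
        rw [if_neg (by simpa using hx), mul_zero]
      · refine summable_of_ne_finset_zero (s := {-Pi.single j 1}) fun x hx => ?_
        rw [if_neg (by simpa using hx), mul_zero]
  simp_rw [e]
  rw [tsum_mul_left, Summable.tsum_finsetSum (fun j _ => hs j)]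
  have e2 : ∀ j : Fin d, ∑' x : Site d,
      (φ x * (if x = Pi.single j 1 then (1 : ℝ) else 0) + φ x * (if x = -Pi.single j 1 then (1 : ℝ) else 0)) =
      φ (Pi.single j 1) + φ (-Pi.single j 1) := fun j => by
    rw [Summable.tsum_add, tsum_mul_ite_eq, tsum_mul_ite_eq]
    · refine summable_of_ne_finset_zero (s := {Pi.single j 1}) fun x hx => ?_
      rw [if_neg (by simpa using hx), mul_zero]
    · refine summable_of_ne_finset_zero (s := {-Pi.single j 1}) fun x hx => ?_
      rw [if_neg (by simpa using hx), mul_zero]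
  simp_rw [e2]
  have hd' : (d : ℝ) ≠ 0 := by exact_mod_cast (show d ≠ 0 by omega)
  field_simp

/-- `−ΔD̂ = D̂`: `lapFT D = D̂` (`‖e‖₂² = 1` on the neighbours). [cite: FitznerVanDerHofstad2016NoBLE, §3.3.3 (3.22) (ΔD̂(k) = −D̂(k)), PTRF p. 1069] -/
theorem lapFT_srwStep (hd : 1 ≤ d) (k : Fin d → ℝ) : lapFT (srwStep d) k = Dhat d k := by
  rw [lapFT_def]
  have e : (fun x => Real.cos (kdot k x) * (normSq x * srwStep d x)) =
      fun x => srwStep d x * (Real.cos (kdot k x) * normSq x) := funext fun x => by ring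
  rw [e, tsum_srwStep_mul hd]
  simp only [kdot_neg, Real.cos_neg, kdot_single_one, normSq_single_one, normSq_neg_single_one, mul_one]
  rw [Dhat]
  have hd' : (d : ℝ) ≠ 0 := by exact_mod_cast (show d ≠ 0 by omega)
  have e2 : ∑ j, (Real.cos (k j) + Real.cos (k j)) = 2 * ∑ j, Real.cos (k j) := by
    rw [Finset.mul_sum]; exact Finset.sum_congr rfl fun j _ => by ring
  rw [e2]
  field_simp

/-- `−∂_s D̂(k) = sin(k_s)/d`: `gradFT s D k = sin(k_s)/d`. [cite: FitznerVanDerHofstad2016NoBLE, §3.3.3 (3.23) (Σ_s (∂_s D̂)² = d⁻² Σ_s sin² k_s =: D̂^{sin}), PTRF p. 1069] -/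
theorem gradFT_srwStep (hd : 1 ≤ d) (s : Fin d) (k : Fin d → ℝ) :
    gradFT s (srwStep d) k = Real.sin (k s) / d := by
  rw [gradFT_def]
  have e : (fun x : Site d => Real.sin (kdot k x) * ((x s : ℝ) * srwStep d x)) =
      fun x => srwStep d x * (Real.sin (kdot k x) * (x s : ℝ)) := funext fun x => by ring
  rw [e, tsum_srwStep_mul hd]
  simp only [kdot_neg, Real.sin_neg, kdot_single_one, Pi.neg_apply, Int.cast_neg, Pi.single_apply,
    neg_mul_neg]
  have e2 : ∀ j : Fin d, Real.sin (k j) * ((if s = j then (1 : ℤ) else 0 : ℤ) : ℝ) +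
      Real.sin (k j) * ((if s = j then (1 : ℤ) else 0 : ℤ) : ℝ) =
      if s = j then 2 * Real.sin (k s) else 0 := fun j => by
    split_ifs with h
    · subst h; simp; ring
    · simp
  simp_rw [e2]
  rw [Finset.sum_ite_eq, if_pos (Finset.mem_univ s)]
  have hd' : (d : ℝ) ≠ 0 := by exact_mod_cast (show d ≠ 0 by omega)
  field_simp

/-- `Σ_s (∂_s D̂(k))² = D̂^{sin}(k)`. [cite: FitznerVanDerHofstad2016NoBLE, §3.3.3 (3.23), PTRF p. 1069] -/
theorem sum_gradFT_srwStep_sq (hd : 1 ≤ d) (k : Fin d → ℝ) :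
    ∑ s, gradFT s (srwStep d) k ^ 2 = Dsin d k := by
  simp_rw [gradFT_srwStep hd]
  rw [Dsin, Finset.sum_div]
  exact Finset.sum_congr rfl fun s _ => by rw [div_pow]

/-- `Σ_s (sin(k_s)/d)² = D̂^{sin}(k)`. [folklore] -/
theorem sum_sin_div_sq (k : Fin d → ℝ) : ∑ s, (Real.sin (k s) / d) ^ 2 = Dsin d k := by
  rw [Dsin, Finset.sum_div]
  exact Finset.sum_congr rfl fun s _ => by rw [div_pow]


/-! ### Linearity of the transforms (local forms) -/

section Lin

variable {f g : Site d → ℝ}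

/-- Additivity of the sine transform. [folklore] -/
theorem sinFT_add_fun (hf : Summable f) (hg : Summable g) (k : Fin d → ℝ) :
    sinFT (fun x => f x + g x) k = sinFT f k + sinFT g k := by
  simp only [sinFT, mul_add]
  exact (summable_sin_kdot_mul hf k).tsum_add (summable_sin_kdot_mul hg k)

/-- The sine transform of a difference. [folklore] -/
theorem sinFT_sub_fun (hf : Summable f) (hg : Summable g) (k : Fin d → ℝ) :
    sinFT (fun x => f x - g x) k = sinFT f k - sinFT g k := by
  simp only [sinFT, mul_sub]
  exact (summable_sin_kdot_mul hf k).tsum_sub (summable_sin_kdot_mul hg k)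

/-- The cosine transform of a difference. [folklore] -/
theorem cosFT_sub_fun (hf : Summable f) (hg : Summable g) (k : Fin d → ℝ) :
    cosFT (fun x => f x - g x) k = cosFT f k - cosFT g k := by
  simp only [cosFT, mul_sub]
  exact (summable_cos_kdot_mul hf k).tsum_sub (summable_cos_kdot_mul hg k)

/-- Homogeneity of the sine transform. [folklore] -/
theorem sinFT_const_mul_fun (c : ℝ) (f : Site d → ℝ) (k : Fin d → ℝ) :
    sinFT (fun x => c * f x) k = c * sinFT f k := by
  simp only [sinFT, ← tsum_mul_left]
  exact tsum_congr fun x => by ring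

/-- The cosine transform of a finite sum. [folklore] -/
theorem cosFT_finset_sum_fun {ι : Type*} (t : Finset ι) (F : ι → Site d → ℝ) (hF : ∀ i ∈ t, Summable (F i))
    (k : Fin d → ℝ) : cosFT (fun x => ∑ i ∈ t, F i x) k = ∑ i ∈ t, cosFT (F i) k := by
  simp only [cosFT, Finset.mul_sum]
  exact Summable.tsum_finsetSum fun i hi => summable_cos_kdot_mul (hF i hi) k

/-- `cosFT (f ∘ neg) = cosFT f`. [folklore] -/
theorem cosFT_comp_neg (f : Site d → ℝ) (k : Fin d → ℝ) : cosFT (fun x => f (-x)) k = cosFT f k := by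
  rw [cosFT, cosFT, ← (Equiv.neg (Site d)).tsum_eq (fun x => Real.cos (kdot k x) * f x)]
  exact tsum_congr fun x => by simp [kdot_neg, Real.cos_neg]

/-- `sinFT (f ∘ neg) = −sinFT f`. [folklore] -/
theorem sinFT_comp_neg (f : Site d → ℝ) (k : Fin d → ℝ) : sinFT (fun x => f (-x)) k = -sinFT f k := by
  rw [sinFT, sinFT, ← (Equiv.neg (Site d)).tsum_eq (fun x => Real.sin (kdot k x) * f x), ← tsum_neg]
  exact tsum_congr fun x => by simp [kdot_neg, Real.sin_neg]

/-- `f ∘ neg` is summable. [folklore] -/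
theorem summable_comp_neg (hf : Summable f) : Summable fun x => f (-x) :=
  (Equiv.neg (Site d)).summable_iff.2 hf

end Lin

/-! ## §2 Fourier uniqueness through the even part; the derivative-free forms of (C.1) -/

/-- The even part `f^e(x) = (f(x) + f(−x))/2`. [folklore] -/
def evenPart (f : Site d → ℝ) : Site d → ℝ := fun x => (f x + f (-x)) / 2

/-- Unfolding lemma. [folklore] -/
theorem evenPart_apply (f : Site d → ℝ) (x : Site d) : evenPart f x = (f x + f (-x)) / 2 := rfl

/-- The even part is even. [folklore] -/
theorem evenPart_neg (f : Site d → ℝ) (x : Site d) : evenPart f (-x) = evenPart f x := by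
  simp only [evenPart_apply, neg_neg]; ring

/-- The even part is summable. [folklore] -/
theorem summable_evenPart {f : Site d → ℝ} (hf : Summable f) : Summable (evenPart f) :=
  (hf.add (summable_comp_neg hf)).div_const 2

/-- The cosine transform only sees the even part. [folklore] -/
theorem cosFT_evenPart {f : Site d → ℝ} (hf : Summable f) (k : Fin d → ℝ) : cosFT (evenPart f) k = cosFT f k := by
  have e : evenPart f = fun x => (1 / 2 : ℝ) * (f x + f (-x)) := funext fun x => by rw [evenPart_apply]; ring
  rw [e, LaceExpansion.cosFT_const_mul, cosFT_add hf (summable_comp_neg hf), cosFT_comp_neg]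
  ring

/-- **Uniqueness**: a symmetric summable function whose cosine transform vanishes on `[−π,π]^d` is zero
(Fourier inversion on the torus). [folklore] -/
theorem eq_zero_of_cosFT_eq_zero {f : Site d → ℝ} (hf : Summable f) (hsym : ∀ x, f (-x) = f x)
    (h0 : ∀ k ∈ cube d, cosFT f k = 0) (x : Site d) : f x = 0 := by
  have h := integral_cube_cos_kdot_mul_cosFT hf hsym x
  have h1 : ∫ k in cube d, Real.cos (kdot k x) * cosFT f k = 0 := by
    have hm : MeasurableSet (cube d) := MeasurableSet.univ_pi fun _ => measurableSet_Icc
    have e : ∫ k in cube d, Real.cos (kdot k x) * cosFT f k = ∫ k in cube d, (0 : ℝ) := by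
      refine setIntegral_congr_fun hm ?_
      intro k hk
      simp only [h0 k hk, mul_zero]
    rw [e]; simp
  rw [h1] at h
  have hpos : (0 : ℝ) < (2 * π) ^ d := by positivity
  rcases mul_eq_zero.mp h.symm with h2 | h2
  · exact absurd h2 hpos.ne'
  · exact h2

/-- The even part of a summable `f` with `f̂ = 0` on `[−π,π]^d` vanishes. [folklore] -/
theorem evenPart_eq_zero_of_cosFT {f : Site d → ℝ} (hf : Summable f) (h0 : ∀ k ∈ cube d, cosFT f k = 0) :
    evenPart f = 0 :=
  funext fun x => eq_zero_of_cosFT_eq_zero (summable_evenPart hf) (evenPart_neg f)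
    (fun k hk => by rw [cosFT_evenPart hf, h0 k hk]) x

/-- If `f̂` vanishes on `[−π,π]^d` then it vanishes everywhere. [folklore] -/
theorem cosFT_eq_zero_of_cube {f : Site d → ℝ} (hf : Summable f) (h0 : ∀ k ∈ cube d, cosFT f k = 0)
    (k : Fin d → ℝ) : cosFT f k = 0 := by
  rw [← cosFT_evenPart hf, evenPart_eq_zero_of_cosFT hf h0, cosFT_zero_fun]

/-- `‖·‖²` commutes with taking the even part. [folklore] -/
theorem mulNormSq_evenPart (f : Site d → ℝ) : mulNormSq (evenPart f) = evenPart (mulNormSq f) := by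
  funext x; simp only [mulNormSq_apply, evenPart_apply, normSq_neg']; ring

/-- `lapFT` only sees the even part. [folklore] -/
theorem lapFT_evenPart {f : Site d → ℝ} (hf2 : Summable (mulNormSq f)) (k : Fin d → ℝ) :
    lapFT (evenPart f) k = lapFT f k := by
  rw [lapFT, mulNormSq_evenPart, cosFT_evenPart hf2, lapFT]

/-- `gradFT` only sees the even part. [folklore] -/
theorem gradFT_evenPart {f : Site d → ℝ} (hf : Summable f) (hf2 : Summable (mulNormSq f)) (s : Fin d)
    (k : Fin d → ℝ) : gradFT s (evenPart f) k = gradFT s f k := by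
  have hs := summable_mulCoord hf hf2 s
  have e : mulCoord s (evenPart f) = fun x => (1 / 2 : ℝ) * (mulCoord s f x - mulCoord s f (-x)) :=
    funext fun x => by simp only [mulCoord_apply, evenPart_apply, Pi.neg_apply, Int.cast_neg]; ring
  rw [gradFT, e, sinFT_const_mul_fun, sinFT_sub_fun hs (summable_comp_neg hs), sinFT_comp_neg, gradFT]
  ring

/-- If `f̂` vanishes on `[−π,π]^d` then `−Δf̂` (typed `lapFT f`) vanishes everywhere. [folklore] -/
theorem lapFT_eq_zero_of_cube {f : Site d → ℝ} (hf : Summable f) (hf2 : Summable (mulNormSq f))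
    (h0 : ∀ k ∈ cube d, cosFT f k = 0) (k : Fin d → ℝ) : lapFT f k = 0 := by
  rw [← lapFT_evenPart hf2, evenPart_eq_zero_of_cosFT hf h0, lapFT]
  have : mulNormSq (0 : Site d → ℝ) = 0 := funext fun x => by simp [mulNormSq]
  rw [this, cosFT_zero_fun]

/-- If `f̂` vanishes on `[−π,π]^d` then `∂_s f̂` (typed `gradFT s f`) vanishes everywhere. [folklore] -/
theorem gradFT_eq_zero_of_cube {f : Site d → ℝ} (hf : Summable f) (hf2 : Summable (mulNormSq f))
    (h0 : ∀ k ∈ cube d, cosFT f k = 0) (s : Fin d) (k : Fin d → ℝ) : gradFT s f k = 0 := by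
  rw [← gradFT_evenPart hf hf2, evenPart_eq_zero_of_cosFT hf h0, gradFT]
  have : mulCoord s (0 : Site d → ℝ) = 0 := funext fun x => by simp [mulCoord]
  rw [this, sinFT_zero_fun]

/-! ### Transforms of a convolution with a symmetric factor -/

section ConvEven

variable {F G : Site d → ℝ}

/-- `∂_s(F̂Ĝ) = ∂_sF̂ Ĝ + F̂ ∂_sĜ` in derivative-free form, `G` even. [folklore] -/
theorem gradFT_latticeConv_of_even (hF : Summable F) (hF2 : Summable (mulNormSq F)) (hG : Summable G)
    (hG2 : Summable (mulNormSq G)) (hGs : ∀ x, G (-x) = G x) (s : Fin d) (k : Fin d → ℝ) :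
    gradFT s (latticeConv F G) k = gradFT s F k * cosFT G k + cosFT F k * gradFT s G k := by
  have hFs := summable_mulCoord hF hF2 s
  have hGs' := summable_mulCoord hG hG2 s
  have e : mulCoord s (latticeConv F G) = fun x => latticeConv (mulCoord s F) G x + latticeConv F (mulCoord s G) x :=
    funext fun x => mulCoord_latticeConv s hF hG hFs hGs' x
  rw [gradFT, e, sinFT_add_fun (summable_latticeConv_of_summable hFs hG) (summable_latticeConv_of_summable hF hGs'),
    sinFT_latticeConv_eq_add hFs hG, sinFT_latticeConv_eq_add hF hGs', sinFT_eq_zero_of_even hGs,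
    cosFT_mulCoord_eq_zero_of_even hGs, ← gradFT, ← gradFT]
  ring

/-- `−Δ(F̂Ĝ) = (−ΔF̂)Ĝ + F̂(−ΔĜ) − 2Σ_s ∂_sF̂ ∂_sĜ` in derivative-free form, `G` even. [folklore] -/
theorem lapFT_latticeConv_of_even (hF : Summable F) (hF2 : Summable (mulNormSq F)) (hG : Summable G)
    (hG2 : Summable (mulNormSq G)) (hGs : ∀ x, G (-x) = G x) (k : Fin d → ℝ) :
    lapFT (latticeConv F G) k =
      lapFT F k * cosFT G k + cosFT F k * lapFT G k - 2 * ∑ s, gradFT s F k * gradFT s G k := by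
  have hFs := summable_mulCoord hF hF2
  have hGs' := summable_mulCoord hG hG2
  have e : mulNormSq (latticeConv F G) = fun x => (latticeConv (mulNormSq F) G x + latticeConv F (mulNormSq G) x) +
      (2 : ℝ) * ∑ s, latticeConv (mulCoord s F) (mulCoord s G) x :=
    funext fun x => mulNormSq_latticeConv hF hG hF2 hG2 x
  have h1 := summable_latticeConv_of_summable hF2 hG
  have h2 := summable_latticeConv_of_summable hF hG2
  have h3 : ∀ s, Summable (latticeConv (mulCoord s F) (mulCoord s G)) := fun s =>
    summable_latticeConv_of_summable (hFs s) (hGs' s)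
  have h3' : Summable fun x => ∑ s, latticeConv (mulCoord s F) (mulCoord s G) x := summable_sum fun s _ => h3 s
  rw [lapFT, e, cosFT_add (h1.add h2) (h3'.mul_left 2), cosFT_add h1 h2, LaceExpansion.cosFT_const_mul,
    cosFT_finset_sum_fun _ _ (fun s _ => h3 s), cosFT_latticeConv_eq_sub hF2 hG, cosFT_latticeConv_eq_sub hF hG2,
    sinFT_eq_zero_of_even hGs, sinFT_mulNormSq_eq_zero_of_even hGs]
  simp_rw [cosFT_latticeConv_eq_sub (hFs _) (hGs' _), cosFT_mulCoord_eq_zero_of_even hGs]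
  simp only [lapFT, gradFT, mul_zero, sub_zero, zero_sub, Finset.sum_neg_distrib, mul_neg]
  ring

/-- `‖·‖²(F⋆G)` is summable when `F, G, ‖·‖²F, ‖·‖²G` are. [folklore] -/
theorem summable_mulNormSq_latticeConv (hF : Summable F) (hF2 : Summable (mulNormSq F)) (hG : Summable G)
    (hG2 : Summable (mulNormSq G)) : Summable (mulNormSq (latticeConv F G)) := by
  have e : mulNormSq (latticeConv F G) = fun x => (latticeConv (mulNormSq F) G x + latticeConv F (mulNormSq G) x) +
      (2 : ℝ) * ∑ s, latticeConv (mulCoord s F) (mulCoord s G) x :=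
    funext fun x => mulNormSq_latticeConv hF hG hF2 hG2 x
  rw [e]
  exact ((summable_latticeConv_of_summable hF2 hG).add (summable_latticeConv_of_summable hF hG2)).add
    ((summable_sum fun s _ => summable_latticeConv_of_summable (summable_mulCoord hF hF2 s)
      (summable_mulCoord hG hG2 s)).mul_left 2)

end ConvEven

/-! ### The x-space functions `c δ₀ + α D + R` of the NoBLE rewrite -/

/-- `Φ_z(x) = c_{Φ,z} δ₀(x) + α_{Φ,z} D(x) + R_{Φ,z}(x)` (and the same shape for `F_z`): the x-space function whose
transform is the printed `Φ̂_z(k) = c_{Φ,z} + α_{Φ,z} D̂(k) + R̂_{Φ,z}(k)`. [cite: FitznerVanDerHofstad2016NoBLE, §1.3 (1.35)–(1.36), PTRF p. 1050] -/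
def nobleXFun (d : ℕ) (c α : ℝ) (R : Site d → ℝ) : Site d → ℝ := fun x => c * delta0 x + α * srwStep d x + R x

section XFun

variable {c α : ℝ} {R : Site d → ℝ}

/-- Unfolding lemma. [folklore] -/
theorem nobleXFun_apply (x : Site d) : nobleXFun d c α R x = c * delta0 x + α * srwStep d x + R x := rfl

/-- `c δ₀ + α D + R` is summable for summable `R`. [folklore] -/
theorem summable_nobleXFun (hR : Summable R) : Summable (nobleXFun d c α R) := by
  have hδ : Summable (delta0 : Site d → ℝ) :=
    summable_of_ne_finset_zero (s := ({0} : Finset (Site d))) fun x hx => delta0_of_ne_zero (by simpa using hx)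
  exact ((hδ.mul_left c).add (summable_srwStep.mul_left α)).add hR

/-- `‖x‖₂² D(x) = D(x)` (the steps have unit length). [folklore] -/
theorem mulNormSq_srwStep (hd : 1 ≤ d) : mulNormSq (srwStep d) = srwStep d := by
  funext x
  rw [mulNormSq_apply, srwStep_eq_bondJ_one hd, bondJ_eq_mul_sum_ite, Set.Icc.coe_one, one_mul, Finset.mul_sum,
    Finset.mul_sum]
  refine Finset.sum_congr rfl fun j _ => ?_
  by_cases h1 : x = Pi.single j 1
  · subst h1
    have h2 : (Pi.single j (1:ℤ) : Site d) ≠ -Pi.single j 1 := by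
      intro h; have := congrArg (fun f => f j) h; simp at this
    simp [h2, normSq_single_one]
  · by_cases h2 : x = -Pi.single j 1
    · subst h2; simp [h1, normSq_neg_single_one]
    · simp [h1, h2]

/-- `‖·‖² D` is summable. [folklore] -/
theorem summable_mulNormSq_srwStep (hd : 1 ≤ d) : Summable (mulNormSq (srwStep d)) := by
  rw [mulNormSq_srwStep hd]; exact summable_srwStep

/-- `‖x‖²(c δ₀ + α D + R)(x) = α D(x) + ‖x‖² R(x)`. [folklore] -/
theorem mulNormSq_nobleXFun (hd : 1 ≤ d) :
    mulNormSq (nobleXFun d c α R) = fun x => α * srwStep d x + mulNormSq R x := by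
  funext x
  have h1 := congrFun (mulNormSq_delta0 (d := d)) x
  have h2 := congrFun (mulNormSq_srwStep hd) x
  simp only [mulNormSq_apply, Pi.zero_apply] at h1 h2
  simp only [mulNormSq_apply, nobleXFun_apply]
  linear_combination c * h1 + α * h2

/-- `‖·‖²(c δ₀ + α D + R)` is summable. [folklore] -/
theorem summable_mulNormSq_nobleXFun (hd : 1 ≤ d) (hR2 : Summable (mulNormSq R)) :
    Summable (mulNormSq (nobleXFun d c α R)) := by
  rw [mulNormSq_nobleXFun hd]; exact (summable_srwStep.mul_left α).add hR2

/-- `Φ̂(k) = c + α D̂(k) + R̂(k)`. [cite: FitznerVanDerHofstad2016NoBLE, §1.3 (1.35)–(1.36), PTRF p. 1050] -/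
theorem cosFT_nobleXFun (hd : 1 ≤ d) (hR : Summable R) (k : Fin d → ℝ) :
    cosFT (nobleXFun d c α R) k = c + α * Dhat d k + cosFT R k := by
  have e : nobleXFun d c α R = fun x => ((fun x => c * delta0 x) x + (fun x => α * srwStep d x) x) + R x := rfl
  have hδ : Summable (delta0 : Site d → ℝ) :=
    summable_of_ne_finset_zero (s := ({0} : Finset (Site d))) fun x hx => delta0_of_ne_zero (by simpa using hx)
  rw [e, cosFT_add ((hδ.mul_left c).add (summable_srwStep.mul_left α)) hR,
    cosFT_add (hδ.mul_left c) (summable_srwStep.mul_left α), LaceExpansion.cosFT_const_mul,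
    LaceExpansion.cosFT_const_mul, cosFT_delta0, cosFT_srwStep hd]
  ring

/-- `−ΔΦ̂(k) = α D̂(k) − ΔR̂(k)`, i.e. (C.5) in derivative-free form. [cite: FitznerVanDerHofstad2016NoBLE, App. C (C.5), PTRF p. 1107] -/
theorem lapFT_nobleXFun (hd : 1 ≤ d) (hR2 : Summable (mulNormSq R)) (k : Fin d → ℝ) :
    lapFT (nobleXFun d c α R) k = α * Dhat d k + lapFT R k := by
  rw [lapFT, mulNormSq_nobleXFun hd]
  have e : (fun x => α * srwStep d x + mulNormSq R x) = fun x => (fun x => α * srwStep d x) x + mulNormSq R x := rfl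
  rw [e, cosFT_add (summable_srwStep.mul_left α) hR2, LaceExpansion.cosFT_const_mul, cosFT_srwStep hd, lapFT]

/-- `x_s (c δ₀ + α D + R)(x) = α x_s D(x) + x_s R(x)`. [folklore] -/
theorem mulCoord_nobleXFun (s : Fin d) :
    mulCoord s (nobleXFun d c α R) = fun x => α * mulCoord s (srwStep d) x + mulCoord s R x := by
  funext x
  have h1 := congrFun (mulCoord_delta0 (d := d) s) x
  simp only [mulCoord_apply, Pi.zero_apply] at h1
  simp only [mulCoord_apply, nobleXFun_apply]
  linear_combination c * h1

/-- `−∂_sΦ̂(k) = α sin(k_s)/d − ∂_sR̂(k)` in derivative-free form. [cite: FitznerVanDerHofstad2016NoBLE, App. C (C.5), PTRF p. 1107] -/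
theorem gradFT_nobleXFun (hd : 1 ≤ d) (hR : Summable R) (hR2 : Summable (mulNormSq R)) (s : Fin d)
    (k : Fin d → ℝ) : gradFT s (nobleXFun d c α R) k = α * (Real.sin (k s) / d) + gradFT s R k := by
  rw [gradFT, mulCoord_nobleXFun]
  have hs := summable_mulCoord (summable_srwStep (d := d)) (summable_mulNormSq_srwStep hd) s
  have e : (fun x => α * mulCoord s (srwStep d) x + mulCoord s R x) =
      fun x => (fun x => α * mulCoord s (srwStep d) x) x + mulCoord s R x := rfl
  rw [e, sinFT_add_fun (hs.mul_left α) (summable_mulCoord hR hR2 s), sinFT_const_mul_fun, ← gradFT,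
    gradFT_srwStep hd, ← gradFT]

end XFun

/-! ### The three k-space identities behind (C.1), for a general symmetric `G` -/

/-- **Derivative-free (C.1).**  Let `G` be symmetric and summable with `Σ‖x‖²|G(x)| < ∞`, and suppose its
transform has the simplified NoBLE form `Ĝ(k)[1 − F̂(k)] = Φ̂(k)` on `[−π,π]^d`, `Φ̂ = c_Φ + α_Φ D̂ + R̂_Φ`,
`F̂ = c_F + α_F D̂ + R̂_F` with summable `R_Φ, R_F` of finite second moment (no symmetry of the remainders is
assumed).  Then for EVERY `k`: `Ĝ(1 − F̂) = Φ̂`; `∂_sĜ (1 − F̂) = ∂_sΦ̂ + ∂_sF̂ Ĝ`;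
`(−ΔĜ)(1 − F̂) = −ΔΦ̂ + (−ΔF̂)Ĝ − 2Σ_s ∂_sF̂ ∂_sĜ` — in the typed transforms `gradFT` (`= −∂`) and `lapFT`
(`= −Δ`), with `∂_s D̂ ↦ sin(k_s)/d`, `−ΔD̂ ↦ D̂`.  (Proof: the even part of `G − Φ − F⋆G` has vanishing
transform, hence vanishes; its weighted transforms are those of `G − Φ − F⋆G`.)
[cite: FitznerVanDerHofstad2016NoBLE, App. C (C.1), (C.5), PTRF p. 1107] -/
theorem noble_kspace_identities (hd : 1 ≤ d) {G : Site d → ℝ} (hG : Summable G) (hGs : ∀ x, G (-x) = G x)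
    (hG2 : Summable (mulNormSq G)) {cΦ αΦ cF αF : ℝ} {RΦ RF : Site d → ℝ} (hRΦ : Summable RΦ)
    (hRF : Summable RF) (hRΦ2 : Summable (mulNormSq RΦ)) (hRF2 : Summable (mulNormSq RF))
    (hform : ∀ k ∈ cube d,
      cosFT G k * (1 - (cF + αF * Dhat d k + cosFT RF k)) = cΦ + αΦ * Dhat d k + cosFT RΦ k)
    (k : Fin d → ℝ) :
    cosFT G k * (1 - (cF + αF * Dhat d k + cosFT RF k)) = cΦ + αΦ * Dhat d k + cosFT RΦ k ∧
    (∀ s, gradFT s G k * (1 - (cF + αF * Dhat d k + cosFT RF k)) =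
        (αΦ * (Real.sin (k s) / d) + gradFT s RΦ k) + (αF * (Real.sin (k s) / d) + gradFT s RF k) * cosFT G k) ∧
    lapFT G k * (1 - (cF + αF * Dhat d k + cosFT RF k)) =
        (αΦ * Dhat d k + lapFT RΦ k) + (αF * Dhat d k + lapFT RF k) * cosFT G k
          - 2 * ∑ s, (αF * (Real.sin (k s) / d) + gradFT s RF k) * gradFT s G k := by
  -- the x-space functions and `h = G − Φ − F⋆G`
  set Φx : Site d → ℝ := nobleXFun d cΦ αΦ RΦ with hΦx
  set Fx : Site d → ℝ := nobleXFun d cF αF RF with hFx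
  have hΦs : Summable Φx := summable_nobleXFun hRΦ
  have hFs : Summable Fx := summable_nobleXFun hRF
  have hΦ2 : Summable (mulNormSq Φx) := summable_mulNormSq_nobleXFun hd hRΦ2
  have hF2 : Summable (mulNormSq Fx) := summable_mulNormSq_nobleXFun hd hRF2
  have hFG : Summable (latticeConv Fx G) := summable_latticeConv_of_summable hFs hG
  have hFG2 : Summable (mulNormSq (latticeConv Fx G)) := summable_mulNormSq_latticeConv hFs hF2 hG hG2
  set h : Site d → ℝ := fun x => (G x - Φx x) - latticeConv Fx G x with hh
  have hhs : Summable h := (hG.sub hΦs).sub hFG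
  have hh2 : Summable (mulNormSq h) := by
    have e : mulNormSq h = fun x => (mulNormSq G x - mulNormSq Φx x) - mulNormSq (latticeConv Fx G) x :=
      funext fun x => by simp only [mulNormSq_apply, hh]; ring
    rw [e]; exact (hG2.sub hΦ2).sub hFG2
  -- the transforms of `h`
  have cosFT_h : ∀ k, cosFT h k = cosFT G k - (cΦ + αΦ * Dhat d k + cosFT RΦ k) -
      (cF + αF * Dhat d k + cosFT RF k) * cosFT G k := fun k => by
    rw [hh, cosFT_sub_fun (hG.sub hΦs) hFG, cosFT_sub_fun hG hΦs, cosFT_latticeConv hFs hG hGs,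
      hΦx, hFx, cosFT_nobleXFun hd hRΦ, cosFT_nobleXFun hd hRF]
  have h0 : ∀ k ∈ cube d, cosFT h k = 0 := fun k hk => by
    rw [cosFT_h]; linear_combination hform k hk
  have gradFT_h : ∀ s, gradFT s h k = gradFT s G k - (αΦ * (Real.sin (k s) / d) + gradFT s RΦ k) -
      ((αF * (Real.sin (k s) / d) + gradFT s RF k) * cosFT G k +
        (cF + αF * Dhat d k + cosFT RF k) * gradFT s G k) := fun s => by
    have e : mulCoord s h = fun x => (mulCoord s G x - mulCoord s Φx x) - mulCoord s (latticeConv Fx G) x :=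
      funext fun x => by simp only [mulCoord_apply, hh]; ring
    rw [gradFT, e, sinFT_sub_fun ((summable_mulCoord hG hG2 s).sub (summable_mulCoord hΦs hΦ2 s))
      (summable_mulCoord hFG hFG2 s), sinFT_sub_fun (summable_mulCoord hG hG2 s) (summable_mulCoord hΦs hΦ2 s),
      ← gradFT, ← gradFT, ← gradFT, gradFT_latticeConv_of_even hFs hF2 hG hG2 hGs, hΦx, hFx,
      gradFT_nobleXFun hd hRΦ hRΦ2, gradFT_nobleXFun hd hRF hRF2, cosFT_nobleXFun hd hRF]
  have lapFT_h : lapFT h k = lapFT G k - (αΦ * Dhat d k + lapFT RΦ k) -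
      ((αF * Dhat d k + lapFT RF k) * cosFT G k + (cF + αF * Dhat d k + cosFT RF k) * lapFT G k -
        2 * ∑ s, (αF * (Real.sin (k s) / d) + gradFT s RF k) * gradFT s G k) := by
    have e : mulNormSq h = fun x => (mulNormSq G x - mulNormSq Φx x) - mulNormSq (latticeConv Fx G) x :=
      funext fun x => by simp only [mulNormSq_apply, hh]; ring
    rw [lapFT, e, cosFT_sub_fun (hG2.sub hΦ2) hFG2, cosFT_sub_fun hG2 hΦ2, ← lapFT, ← lapFT, ← lapFT,
      lapFT_latticeConv_of_even hFs hF2 hG hG2 hGs, hΦx, hFx, lapFT_nobleXFun hd hRΦ2, lapFT_nobleXFun hd hRF2,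
      cosFT_nobleXFun hd hRF]
    simp_rw [gradFT_nobleXFun hd hRF hRF2]
  -- the even part of `h` vanishes, hence all three transforms of `h` vanish at `k`
  have z0 : cosFT h k = 0 := cosFT_eq_zero_of_cube hhs h0 k
  have z1 : ∀ s, gradFT s h k = 0 := fun s => gradFT_eq_zero_of_cube hhs hh2 h0 s k
  have z2 : lapFT h k = 0 := lapFT_eq_zero_of_cube hhs hh2 h0 k
  refine ⟨?_, fun s => ?_, ?_⟩
  · rw [cosFT_h] at z0; linear_combination z0
  · have z := z1 s; rw [gradFT_h s] at z; linear_combination z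
  · rw [lapFT_h] at z2; linear_combination z2


/-! ## §3 The algebra of App. C as a kernel identity -/

/-- The fourteen real numbers a point `k` contributes to (3.52)–(3.57): `c_Φ, α_Φ, α_F`, `D = D̂(k)`,
`Dsin = D̂^{sin}(k)`, `RΦ = R̂_Φ(k)`, `Q = 1 − F̂(k)`, `δRF = δ_{R,F}(k) = R̂_F(0) − R̂_F(k)`, `LΦ = −ΔR̂_Φ(k)`,
`LF = −ΔR̂_F(k)`, and the gradient sums `SDΦ = Σ_s ∂_sD̂ ∂_sR̂_Φ`, `SDF = Σ_s ∂_sD̂ ∂_sR̂_F`,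
`SΦF = Σ_s ∂_sR̂_Φ ∂_sR̂_F`, `SFF = Σ_s (∂_sR̂_F)²`. [cite: FitznerVanDerHofstad2016NoBLE, §3.3.4 (3.44)–(3.45) and (3.52)–(3.56), PTRF pp. 1072–1073] -/
structure LapAtoms where
  /-- `c_{Φ,z}` -/
  cΦ : ℝ
  /-- `α_{Φ,z}` -/
  αΦ : ℝ
  /-- `α_{F,z}` -/
  αF : ℝ
  /-- `D̂(k)` -/
  D : ℝ
  /-- `D̂^{sin}(k)` -/
  Dsin : ℝ
  /-- `R̂_{Φ,z}(k)` -/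
  RΦ : ℝ
  /-- `1 − F̂_z(k)` -/
  Q : ℝ
  /-- `δ_{R,F}(k) = R̂_{F,z}(0) − R̂_{F,z}(k)` -/
  δRF : ℝ
  /-- `−ΔR̂_{Φ,z}(k)` -/
  LΦ : ℝ
  /-- `−ΔR̂_{F,z}(k)` -/
  LF : ℝ
  /-- `Σ_s ∂_sD̂(k) ∂_sR̂_{Φ,z}(k)` -/
  SDΦ : ℝ
  /-- `Σ_s ∂_sD̂(k) ∂_sR̂_{F,z}(k)` -/
  SDF : ℝ
  /-- `Σ_s ∂_sR̂_{Φ,z}(k) ∂_sR̂_{F,z}(k)` -/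
  SΦF : ℝ
  /-- `Σ_s (∂_sR̂_{F,z}(k))²` -/
  SFF : ℝ

namespace LapAtoms

variable (a : LapAtoms)

/-- `Φ̂_z(k) = c_Φ + α_Φ D̂(k) + R̂_Φ(k)`. [cite: FitznerVanDerHofstad2016NoBLE, §1.3 (1.35), PTRF p. 1050] -/
def Phi : ℝ := a.cΦ + a.αΦ * a.D + a.RΦ

/-- `Ĝ_z(k) = Φ̂_z(k)/(1 − F̂_z(k))`. [cite: FitznerVanDerHofstad2016NoBLE, §1.3 (1.32) and (1.37), PTRF pp. 1049–1050] -/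
def G : ℝ := a.Phi / a.Q

/-- The denominator of `Ĉ*`: `1 − F̂_z(0) + α_F[1 − D̂(k)] = (1 − F̂_z(k)) − δ_{R,F}(k)`.
[cite: FitznerVanDerHofstad2016NoBLE, §3.3.4 (3.40), PTRF p. 1072] -/
def Cden : ℝ := a.Q - a.δRF

/-- `Ĉ*(k) = 1/(1 − F̂_z(0) + α_F[1 − D̂(k)])`. [cite: FitznerVanDerHofstad2016NoBLE, §3.3.4 (3.40), PTRF p. 1072] -/
def Cstar : ℝ := 1 / a.Cden

/-- `Ê(k) = δ_{R,F}(k) Ĉ*(k)/(1 − F̂_z(k))`. [cite: FitznerVanDerHofstad2016NoBLE, §3.3.4 (3.45), PTRF p. 1072] -/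
def E : ℝ := a.δRF * a.Cstar / a.Q

/-- `M̂*(k) = D̂(k) − 2 D̂^{sin}(k) Ĉ*(k)`. [cite: FitznerVanDerHofstad2016NoBLE, §3.3.4 (3.45), PTRF p. 1072] -/
def Mstar : ℝ := a.D - 2 * a.Dsin * a.Cstar

/-- `−ΔΦ̂_z(k) = α_Φ D̂(k) − ΔR̂_Φ(k)`. [cite: FitznerVanDerHofstad2016NoBLE, App. C (C.5), PTRF p. 1107] -/
def lapPhi : ℝ := a.αΦ * a.D + a.LΦ

/-- `−ΔF̂_z(k) = α_F D̂(k) − ΔR̂_F(k)`. [cite: FitznerVanDerHofstad2016NoBLE, App. C (C.5), PTRF p. 1107] -/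
def lapF : ℝ := a.αF * a.D + a.LF

/-- `Σ_s (∂_sF̂_z(k))² = α_F² D̂^{sin} + 2α_F Σ_s ∂_sD̂ ∂_sR̂_F + Σ_s (∂_sR̂_F)²`.
[cite: FitznerVanDerHofstad2016NoBLE, App. C (C.8), PTRF p. 1109] -/
def gradFsq : ℝ := a.αF ^ 2 * a.Dsin + 2 * a.αF * a.SDF + a.SFF

/-- `Σ_s ∂_sΦ̂_z(k) ∂_sF̂_z(k) = α_Φα_F D̂^{sin} + α_Φ Σ_s ∂_sD̂ ∂_sR̂_F + α_F Σ_s ∂_sD̂ ∂_sR̂_Φ + Σ_s ∂_sR̂_Φ ∂_sR̂_F`.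
[cite: FitznerVanDerHofstad2016NoBLE, App. C (C.9), PTRF p. 1109] -/
def gradPhiF : ℝ := a.αΦ * a.αF * a.Dsin + a.αΦ * a.SDF + a.αF * a.SDΦ + a.SΦF

/-- The quotient-rule form (C.1) of `−ΔĜ_z(k)`:
`−ΔĜ = (−ΔΦ̂)/(1 − F̂) + Φ̂[(−ΔF̂)/(1 − F̂)² − 2Σ_s(∂_sF̂)²/(1 − F̂)³] − 2Σ_s ∂_sΦ̂ ∂_sF̂/(1 − F̂)²`.
[cite: FitznerVanDerHofstad2016NoBLE, App. C (C.1), PTRF p. 1107] -/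
def negLapG : ℝ :=
  a.lapPhi / a.Q + a.Phi * (a.lapF / a.Q ^ 2 - 2 * a.gradFsq / a.Q ^ 3) - 2 * a.gradPhiF / a.Q ^ 2

/-- `Ĥ₁(k) = (α_F (c_Φ + α_Φ D̂(k)) Ĉ*(k) + α_Φ) Ĉ*(k) M̂*(k)`. [cite: FitznerVanDerHofstad2016NoBLE, §3.3.4 (3.52), PTRF p. 1073] -/
def H1 : ℝ := (a.αF * (a.cΦ + a.αΦ * a.D) * a.Cstar + a.αΦ) * a.Cstar * a.Mstar

/-- `Ĥ₂(k) = −(α_F (c_Φ + α_Φ D̂)(Ĉ* + 1/(1 − F̂)) + α_Φ) Ê M̂* + α_F R̂_Φ/(1 − F̂)² · M̂*`.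
[cite: FitznerVanDerHofstad2016NoBLE, §3.3.4 (3.53), PTRF p. 1073] -/
def H2 : ℝ := -((a.αF * (a.cΦ + a.αΦ * a.D) * (a.Cstar + 1 / a.Q) + a.αΦ) * a.E * a.Mstar)
    + a.αF * (a.RΦ / a.Q ^ 2) * a.Mstar

/-- `Ĥ₃(k) = 2 (D̂^{sin}/(1 − F̂)) (α_F Ĝ + α_Φ)(Ê − (α_F − 1)/(1 − F̂))`.
[cite: FitznerVanDerHofstad2016NoBLE, §3.3.4 (3.54), PTRF p. 1073] -/
def H3 : ℝ := 2 * (a.Dsin / a.Q) * (a.αF * a.G + a.αΦ) * (a.E - (a.αF - 1) / a.Q)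

/-- `Ĥ₄(k) = −ΔR̂_Φ/(1 − F̂) − (ΔR̂_F/(1 − F̂)) Ĝ`. [cite: FitznerVanDerHofstad2016NoBLE, §3.3.4 (3.55), PTRF p. 1073] -/
def H4 : ℝ := a.LΦ / a.Q + a.LF / a.Q * a.G

/-- `Ĥ₅(k) = −2[Σ_s (∂_sR̂_F)² + 2α_F ∂_sD̂ ∂_sR̂_F]/(1 − F̂)² · Ĝ − (2/(1 − F̂)²) Σ_s(∂_sR̂_Φ α_F ∂_sD̂ + ∂_sΦ̂ ∂_sR̂_F)`
(with `∂_sΦ̂ = α_Φ ∂_sD̂ + ∂_sR̂_Φ`). [cite: FitznerVanDerHofstad2016NoBLE, §3.3.4 (3.56), PTRF p. 1073] -/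
def H5 : ℝ := -2 * ((a.SFF + 2 * a.αF * a.SDF) / a.Q ^ 2) * a.G
    - 2 / a.Q ^ 2 * (a.αF * a.SDΦ + a.αΦ * a.SDF + a.SΦF)

/-- (C.2): `1/(1 − F̂) = Ĉ* − Ê`. [cite: FitznerVanDerHofstad2016NoBLE, App. C (C.2), PTRF p. 1107] -/
theorem one_div_Q (hQ : a.Q ≠ 0) (hC : a.Cden ≠ 0) : 1 / a.Q = a.Cstar - a.E := by
  simp only [Cstar, E, Cden] at *
  field_simp

/-- (C.3): `1/(1 − F̂)² = Ĉ*² − ÊĈ* − Ê/(1 − F̂)`. [cite: FitznerVanDerHofstad2016NoBLE, App. C (C.3), PTRF p. 1107] -/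
theorem one_div_Q_sq (hQ : a.Q ≠ 0) (hC : a.Cden ≠ 0) :
    1 / a.Q ^ 2 = a.Cstar ^ 2 - a.E * a.Cstar - a.E / a.Q := by
  simp only [Cstar, E, Cden] at *
  field_simp

/-- (C.4): `1/(1 − F̂)³ = Ĉ*³ − ÊĈ*² − ÊĈ*/(1 − F̂) − Ê/(1 − F̂)²`. [cite: FitznerVanDerHofstad2016NoBLE, App. C (C.4), PTRF p. 1107] -/
theorem one_div_Q_cube (hQ : a.Q ≠ 0) (hC : a.Cden ≠ 0) :
    1 / a.Q ^ 3 = a.Cstar ^ 3 - a.E * a.Cstar ^ 2 - a.E * a.Cstar / a.Q - a.E / a.Q ^ 2 := by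
  simp only [Cstar, E, Cden] at *
  field_simp

/-- **(3.57) = App. C of [NoBLE17], kernel-checked**: for `1 − F̂_z(k) ≠ 0` and `1 − F̂_z(0) + α_F[1 − D̂(k)] ≠ 0`
the quotient-rule form (C.1) of `−ΔĜ_z(k)` regroups as `Ĥ₁(k) + Ĥ₂(k) + Ĥ₃(k) + Ĥ₄(k) + Ĥ₅(k)` — a
rational-function identity in the fourteen atoms. [cite: FitznerVanDerHofstad2016NoBLE, §3.3.4 (3.57), PTRF p. 1074; App. C (C.1)–(C.14), PTRF pp. 1107–1110] -/
theorem negLapG_eq_sum_H (hQ : a.Q ≠ 0) (hC : a.Cden ≠ 0) :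
    a.negLapG = a.H1 + a.H2 + a.H3 + a.H4 + a.H5 := by
  simp only [negLapG, H1, H2, H3, H4, H5, lapPhi, lapF, gradFsq, gradPhiF, G, E, Mstar, Cstar, Cden,
    Phi] at *
  field_simp
  ring

end LapAtoms

/-! ## §4 The dictionary: atoms at a point `k`, and `tauWHat = Σ Ĥ_i` -/

/-- The atoms at `k` of a simplified-form witness `(c_Φ, α_Φ, c_F, α_F, R_Φ, R_F)`, with the derivatives typed
through `gradFT`/`lapFT` (`∂_sD̂ ↦ sin(k_s)/d`). [cite: FitznerVanDerHofstad2016NoBLE, §3.3.4 (3.44)–(3.45) and (3.52)–(3.56), PTRF pp. 1072–1073] -/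
def lapAtomsAt (d : ℕ) (cΦ αΦ cF αF : ℝ) (RΦ RF : Site d → ℝ) (k : Fin d → ℝ) : LapAtoms where
  cΦ := cΦ
  αΦ := αΦ
  αF := αF
  D := Dhat d k
  Dsin := Dsin d k
  RΦ := cosFT RΦ k
  Q := 1 - (cF + αF * Dhat d k + cosFT RF k)
  δRF := cosFT RF 0 - cosFT RF k
  LΦ := lapFT RΦ k
  LF := lapFT RF k
  SDΦ := ∑ s, Real.sin (k s) / d * gradFT s RΦ k
  SDF := ∑ s, Real.sin (k s) / d * gradFT s RF k
  SΦF := ∑ s, gradFT s RΦ k * gradFT s RF k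
  SFF := ∑ s, gradFT s RF k ^ 2

section Dictionary

variable {cΦ αΦ cF αF : ℝ} {RΦ RF : Site d → ℝ} {k : Fin d → ℝ}

/-- Projection of `lapAtomsAt`. [folklore] -/
@[simp] theorem lapAtomsAt_Q : (lapAtomsAt d cΦ αΦ cF αF RΦ RF k).Q = 1 - (cF + αF * Dhat d k + cosFT RF k) := rfl
/-- Projection of `lapAtomsAt`. [folklore] -/
@[simp] theorem lapAtomsAt_δRF : (lapAtomsAt d cΦ αΦ cF αF RΦ RF k).δRF = cosFT RF 0 - cosFT RF k := rfl
/-- Projection of `lapAtomsAt`. [folklore] -/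
@[simp] theorem lapAtomsAt_D : (lapAtomsAt d cΦ αΦ cF αF RΦ RF k).D = Dhat d k := rfl
/-- Projection of `lapAtomsAt`. [folklore] -/
@[simp] theorem lapAtomsAt_Dsin : (lapAtomsAt d cΦ αΦ cF αF RΦ RF k).Dsin = Dsin d k := rfl
/-- Projection of `lapAtomsAt`. [folklore] -/
@[simp] theorem lapAtomsAt_RΦ : (lapAtomsAt d cΦ αΦ cF αF RΦ RF k).RΦ = cosFT RΦ k := rfl
/-- Projection of `lapAtomsAt`. [folklore] -/
@[simp] theorem lapAtomsAt_cΦ : (lapAtomsAt d cΦ αΦ cF αF RΦ RF k).cΦ = cΦ := rfl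
/-- Projection of `lapAtomsAt`. [folklore] -/
@[simp] theorem lapAtomsAt_αΦ : (lapAtomsAt d cΦ αΦ cF αF RΦ RF k).αΦ = αΦ := rfl
/-- Projection of `lapAtomsAt`. [folklore] -/
@[simp] theorem lapAtomsAt_αF : (lapAtomsAt d cΦ αΦ cF αF RΦ RF k).αF = αF := rfl
/-- Projection of `lapAtomsAt`. [folklore] -/
@[simp] theorem lapAtomsAt_LΦ : (lapAtomsAt d cΦ αΦ cF αF RΦ RF k).LΦ = lapFT RΦ k := rfl
/-- Projection of `lapAtomsAt`. [folklore] -/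
@[simp] theorem lapAtomsAt_LF : (lapAtomsAt d cΦ αΦ cF αF RΦ RF k).LF = lapFT RF k := rfl
/-- Projection of `lapAtomsAt`. [folklore] -/
@[simp] theorem lapAtomsAt_SDΦ :
    (lapAtomsAt d cΦ αΦ cF αF RΦ RF k).SDΦ = ∑ s, Real.sin (k s) / d * gradFT s RΦ k := rfl
/-- Projection of `lapAtomsAt`. [folklore] -/
@[simp] theorem lapAtomsAt_SDF :
    (lapAtomsAt d cΦ αΦ cF αF RΦ RF k).SDF = ∑ s, Real.sin (k s) / d * gradFT s RF k := rfl
/-- Projection of `lapAtomsAt`. [folklore] -/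
@[simp] theorem lapAtomsAt_SΦF :
    (lapAtomsAt d cΦ αΦ cF αF RΦ RF k).SΦF = ∑ s, gradFT s RΦ k * gradFT s RF k := rfl
/-- Projection of `lapAtomsAt`. [folklore] -/
@[simp] theorem lapAtomsAt_SFF : (lapAtomsAt d cΦ αΦ cF αF RΦ RF k).SFF = ∑ s, gradFT s RF k ^ 2 := rfl

/-- The two spellings of the `Ĉ*` denominator agree: `(1 − F̂(k)) − δ_{R,F}(k) = 1 − F̂(0) + α_F[1 − D̂(k)]`
(`D̂(0) = 1`). [cite: FitznerVanDerHofstad2016NoBLE, §3.3.4 (3.40) and (3.44), PTRF p. 1072] -/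
theorem lapAtomsAt_Cden :
    (lapAtomsAt d cΦ αΦ cF αF RΦ RF k).Cden = 1 - (cF + αF + cosFT RF 0) + αF * (1 - Dhat d k) := by
  simp only [LapAtoms.Cden, lapAtomsAt_Q, lapAtomsAt_δRF]
  ring

/-- **`−ΔĜ = Σ_{i=1}^5 Ĥ_i` for a general symmetric `G`.**  Under the hypotheses of `noble_kspace_identities`,
at every `k` with `1 − F̂(k) ≠ 0` and `1 − F̂(0) + α_F[1 − D̂(k)] ≠ 0`: `Ĝ(k) = Φ̂(k)/(1 − F̂(k))` and
`lapFT G k` (`= −ΔĜ(k)`) `= Ĥ₁(k) + ⋯ + Ĥ₅(k)`. [cite: FitznerVanDerHofstad2016NoBLE, §3.3.4 (3.57), PTRF p. 1074; App. C (C.1)–(C.14), PTRF pp. 1107–1110] -/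
theorem lapFT_eq_sum_H (hd : 1 ≤ d) {G : Site d → ℝ} (hG : Summable G) (hGs : ∀ x, G (-x) = G x)
    (hG2 : Summable (mulNormSq G)) (hRΦ : Summable RΦ) (hRF : Summable RF) (hRΦ2 : Summable (mulNormSq RΦ))
    (hRF2 : Summable (mulNormSq RF))
    (hform : ∀ k ∈ cube d,
      cosFT G k * (1 - (cF + αF * Dhat d k + cosFT RF k)) = cΦ + αΦ * Dhat d k + cosFT RΦ k)
    (k : Fin d → ℝ) (hQ : (lapAtomsAt d cΦ αΦ cF αF RΦ RF k).Q ≠ 0)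
    (hC : (lapAtomsAt d cΦ αΦ cF αF RΦ RF k).Cden ≠ 0) :
    cosFT G k = (lapAtomsAt d cΦ αΦ cF αF RΦ RF k).G ∧
    lapFT G k = (lapAtomsAt d cΦ αΦ cF αF RΦ RF k).H1 + (lapAtomsAt d cΦ αΦ cF αF RΦ RF k).H2 +
      (lapAtomsAt d cΦ αΦ cF αF RΦ RF k).H3 + (lapAtomsAt d cΦ αΦ cF αF RΦ RF k).H4 +
      (lapAtomsAt d cΦ αΦ cF αF RΦ RF k).H5 := by
  set a := lapAtomsAt d cΦ αΦ cF αF RΦ RF k with ha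
  obtain ⟨h0, h1, h2⟩ := noble_kspace_identities hd hG hGs hG2 hRΦ hRF hRΦ2 hRF2 hform k
  have hQ' : (1 - (cF + αF * Dhat d k + cosFT RF k)) ≠ 0 := hQ
  -- `Ĝ = Φ̂/Q`
  have hGval : cosFT G k = a.G := by
    rw [ha]; simp only [LapAtoms.G, LapAtoms.Phi, lapAtomsAt_Q, lapAtomsAt_cΦ, lapAtomsAt_αΦ, lapAtomsAt_D,
      lapAtomsAt_RΦ]
    rw [eq_div_iff hQ']; exact h0
  -- the gradient of `Ĝ`
  have hgrad : ∀ s, gradFT s G k = ((αΦ * (Real.sin (k s) / d) + gradFT s RΦ k) +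
      (αF * (Real.sin (k s) / d) + gradFT s RF k) * cosFT G k) / (1 - (cF + αF * Dhat d k + cosFT RF k)) :=
    fun s => by rw [eq_div_iff hQ']; exact h1 s
  refine ⟨hGval, ?_⟩
  -- `lapFT G k = negLapG`: solve the Laplacian identity
  have hlap : lapFT G k = ((αΦ * Dhat d k + lapFT RΦ k) + (αF * Dhat d k + lapFT RF k) * cosFT G k -
      2 * ∑ s, (αF * (Real.sin (k s) / d) + gradFT s RF k) * gradFT s G k) /
        (1 - (cF + αF * Dhat d k + cosFT RF k)) := by
    rw [eq_div_iff hQ']; exact h2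
  -- expand the gradient sum into the atoms
  have hsum : ∑ s, (αF * (Real.sin (k s) / d) + gradFT s RF k) * gradFT s G k =
      (a.gradPhiF + a.gradFsq * cosFT G k) / (1 - (cF + αF * Dhat d k + cosFT RF k)) := by
    simp_rw [hgrad]
    rw [ha]
    simp only [LapAtoms.gradPhiF, LapAtoms.gradFsq, lapAtomsAt_αΦ, lapAtomsAt_αF, lapAtomsAt_Dsin,
      lapAtomsAt_SDΦ, lapAtomsAt_SDF, lapAtomsAt_SΦF, lapAtomsAt_SFF, ← sum_sin_div_sq k]
    rw [eq_div_iff hQ', Finset.sum_mul]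
    simp only [Finset.mul_sum, ← Finset.sum_add_distrib, Finset.sum_mul]
    refine Finset.sum_congr rfl fun s _ => ?_
    field_simp
    ring
  have key : lapFT G k = a.negLapG := by
    rw [hlap, hsum, hGval]
    have eQ : (1 - (cF + αF * Dhat d k + cosFT RF k)) = a.Q := rfl
    have eΦ : αΦ * Dhat d k + lapFT RΦ k = a.lapPhi := rfl
    have eF : αF * Dhat d k + lapFT RF k = a.lapF := rfl
    rw [eQ, eΦ, eF]
    simp only [LapAtoms.negLapG, LapAtoms.G]
    field_simp
    ring
  rw [key]
  exact a.negLapG_eq_sum_H hQ hC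

/-! ### Percolation: `tauWHat = lapFT τ_p` and the split of the `f₃` integrand -/

/-- `tauWHat d p = lapFT (τ_p(0,·))` (`‖y‖₂² = Σ_i y_i²`). [folklore] -/
theorem tauWHat_eq_lapFT (p : unitInterval) (k : Fin d → ℝ) : tauWHat d p k = lapFT (tau d p 0) k := by
  rw [tauWHat_eq_cosFT, lapFT]
  congr 1
  funext y
  simp only [tauW, mulNormSq_apply, euclidNorm, normSq, Real.sq_sqrt (Finset.sum_nonneg fun i _ => sq_nonneg _)]

/-- `Σ‖x‖² τ_p(x) < ∞` below `p_c`, in the `mulNormSq` spelling. [folklore] -/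
theorem summable_mulNormSq_tau (hd : 2 ≤ d) (p : unitInterval)
    (hp : (p : ℝ) < criticalProb (zdGraph d) (0 : Site d)) : Summable (mulNormSq (tau d p 0)) :=
  (summable_normSq_mul_tau_of_lt_criticalProb hd p hp).congr fun x => by simp only [mulNormSq_apply, normSq]

/-- **The split of the `f₃` integrand, [NoBLE17] (3.57) for percolation.**  Let `2 ≤ d`, `p < p_c`, and let
`(c_Φ, α_Φ, c_F, α_F, R_Φ, R_F)` witness the simplified NoBLE form of `τ̂_p` on `[−π,π]^d` with summable
remainders of finite absolute second moment (as recorded in `NobleSimplifiedFormF3At`).  Then at every `k` with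
`1 − F̂(k) ≠ 0` and `1 − F̂(0) + α_F[1 − D̂(k)] ≠ 0`:
`tauWHat d p k` (`= −Δτ̂_p(k)`) `= Ĥ₁(k) + Ĥ₂(k) + Ĥ₃(k) + Ĥ₄(k) + Ĥ₅(k)` and `τ̂_p(k) = Φ̂(k)/(1 − F̂(k))`,
the `Ĥ_i` being the printed (3.52)–(3.56) evaluated on the atoms `lapAtomsAt d c_Φ α_Φ c_F α_F R_Φ R_F k`.
[cite: FitznerVanDerHofstad2016NoBLE, §3.3.4 (3.52)–(3.57), PTRF pp. 1073–1074; App. C (C.1)–(C.14), PTRF pp. 1107–1110] -/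
theorem tauWHat_eq_sum_H (hd : 2 ≤ d) (p : unitInterval) (hp : (p : ℝ) < criticalProb (zdGraph d) (0 : Site d))
    (hRΦ : Summable RΦ) (hRF : Summable RF) (hRΦ2 : Summable fun x => normSq x * |RΦ x|)
    (hRF2 : Summable fun x => normSq x * |RF x|)
    (hform : ∀ k ∈ cube d,
      tauHat d p k * (1 - (cF + αF * Dhat d k + cosFT RF k)) = cΦ + αΦ * Dhat d k + cosFT RΦ k)
    (k : Fin d → ℝ) (hQ : (lapAtomsAt d cΦ αΦ cF αF RΦ RF k).Q ≠ 0)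
    (hC : (lapAtomsAt d cΦ αΦ cF αF RΦ RF k).Cden ≠ 0) :
    tauHat d p k = (lapAtomsAt d cΦ αΦ cF αF RΦ RF k).G ∧
    tauWHat d p k = (lapAtomsAt d cΦ αΦ cF αF RΦ RF k).H1 + (lapAtomsAt d cΦ αΦ cF αF RΦ RF k).H2 +
      (lapAtomsAt d cΦ αΦ cF αF RΦ RF k).H3 + (lapAtomsAt d cΦ αΦ cF αF RΦ RF k).H4 +
      (lapAtomsAt d cΦ αΦ cF αF RΦ RF k).H5 := by
  have hd1 : 1 ≤ d := by omega
  have h := lapFT_eq_sum_H hd1 (summable_tau_of_lt_criticalProb hd p hp) (tau_zero_symm p)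
    (summable_mulNormSq_tau hd p hp) hRΦ hRF (summable_mulNormSq_of_abs hRΦ2) (summable_mulNormSq_of_abs hRF2)
    (fun k hk => by rw [← tauHat_eq_cosFT]; exact hform k hk) k hQ hC
  rw [tauWHat_eq_lapFT, tauHat_eq_cosFT]
  exact h

/-- The same, read off the L0 interface `NobleSimplifiedFormF3At d p B E`: its witnesses
`(c_Φ, α_Φ, c_F, α_F, R_Φ, R_F)` (with the recorded bounds `c̲_Φ ≤ c_Φ ≤ c̄_Φ`, `|α_Φ| ≤ β_{α,Φ}`,
`α̲_F ≤ α_F ≤ ᾱ_F`, `Σ|R_Φ| ≤ β_{R,Φ}`, `Σ|R_F| ≤ β_{R,F}`, `Σ‖x‖²|R_Φ| ≤ β_{ΔR,Φ}`, `Σ‖x‖²|R_F| ≤ β_{|ΔR,F|}`,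
`−β_Δ[1 − D̂] ≤ δ_{R,F}` on the cube) satisfy `τ̂_p = Ĝ` and `tauWHat d p = Σ_i Ĥ_i` wherever the two
denominators are non-zero. [cite: FitznerVanDerHofstad2016NoBLE, §3.3.4 (3.52)–(3.57), PTRF pp. 1073–1074] -/
theorem NobleSimplifiedFormF3At.exists_lapAtoms (hd : 2 ≤ d) {p : unitInterval}
    (hp : (p : ℝ) < criticalProb (zdGraph d) (0 : Site d)) {B : NobleBeta} {E : NobleBetaF3}
    (h : NobleSimplifiedFormF3At d p B E) :
    ∃ (cΦ αΦ cF αF : ℝ) (RΦ RF : Site d → ℝ), Summable RΦ ∧ Summable RF ∧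
      (∀ k ∈ cube d, tauHat d p k * (1 - (cF + αF * Dhat d k + cosFT RF k)) =
        cΦ + αΦ * Dhat d k + cosFT RΦ k) ∧
      E.cΦlow ≤ cΦ ∧ cΦ ≤ B.cΦup ∧ |αΦ| ≤ B.βαΦ ∧ B.αFlow ≤ αF ∧ αF ≤ E.αFup ∧
      ∑' x, |RΦ x| ≤ B.βRΦ ∧ ∑' x, |RF x| ≤ E.βRF ∧
      Summable (fun x => normSq x * |RΦ x|) ∧ ∑' x, normSq x * |RΦ x| ≤ E.βΔRΦ ∧
      Summable (fun x => normSq x * |RF x|) ∧ ∑' x, normSq x * |RF x| ≤ E.βΔRFabs ∧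
      (∀ k ∈ cube d, -(B.βΔ * (1 - Dhat d k)) ≤ cosFT RF 0 - cosFT RF k) ∧
      ∀ k, (lapAtomsAt d cΦ αΦ cF αF RΦ RF k).Q ≠ 0 → (lapAtomsAt d cΦ αΦ cF αF RΦ RF k).Cden ≠ 0 →
        tauHat d p k = (lapAtomsAt d cΦ αΦ cF αF RΦ RF k).G ∧
        tauWHat d p k = (lapAtomsAt d cΦ αΦ cF αF RΦ RF k).H1 + (lapAtomsAt d cΦ αΦ cF αF RΦ RF k).H2 +
          (lapAtomsAt d cΦ αΦ cF αF RΦ RF k).H3 + (lapAtomsAt d cΦ αΦ cF αF RΦ RF k).H4 +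
          (lapAtomsAt d cΦ αΦ cF αF RΦ RF k).H5 := by
  obtain ⟨cΦ, αΦ, cF, αF, RΦ, RF, hRΦ, hRF, hform, hcΦlow, hcΦ, hαΦ, hαF, hαFup, hRΦle, hRFle, hsΦ, hΔΦ,
    hsF, hΔF, hRFb⟩ := h.exists_coefficients
  exact ⟨cΦ, αΦ, cF, αF, RΦ, RF, hRΦ, hRF, hform, hcΦlow, hcΦ, hαΦ, hαF, hαFup, hRΦle, hRFle, hsΦ, hΔΦ, hsF,
    hΔF, hRFb, fun k hQ hC => tauWHat_eq_sum_H hd p hp hRΦ hRF hsΦ hsF hform k hQ hC⟩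

end Dictionary

end Literature.Probability.FitznerVanDerHofstad2017
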